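import Mathlib

/-!
# Ridout's theorem over `ℚ` with integer `p`-adic targets, in the `padicNorm` vocabulary

Stub `stub_zeroInt_of_rat` (S2′) of the line `SketchIdeator5R2` for the crux `DeepRegimeABC`
(stmt-ABC-15121): a pure translation, with no Diophantine content.

The neighbouring stubs prove Ridout's theorem over `ℚ` (Bombieri–Gubler, *Heights in Diophantine
Geometry*, Thm. 6.2.3 for `K = ℚ`, archimedean target `0`, `|β| ≤ 1` [BombieriGubler2006];
[Ridout1958]) in the tree's vocabulary: places are a `Finset Nat.Primes`, the `p`-adic targets
`θ_p ∈ \overline{ℚ_p} = PadicAlgCl p` are roots of monic integer polynomials `Q_p`, and closeness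
is measured by the (spectral) norm of `PadicAlgCl p`:
*for `κ > 2` only finitely many `ρ ∈ ℚ`, `|ρ| ≤ 1`, satisfy
`|ρ| · ∏_{p ∈ S} min(1, ‖ρ − θ_p‖) ≤ den(ρ)^{−κ}`.*

`stub_zeroInt_of_rat` deduces the special case of INTEGER targets `k_p ∈ ℤ` in the
elementary vocabulary consumed by the abc side of the line: places are a `Finset ℕ` of primes and
closeness is `padicNorm p (ρ − k_p)`. The proof takes `Q_p = X − k_p`, `θ_p = k_p`, reindexes the
product along `Finset.subtype Nat.Prime` (`Finset.prod_nbij` with `p ↦ ↑p`) and uses the norm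
compatibility
`‖(q : PadicAlgCl p)‖ = padicNorm p q` for `q ∈ ℚ` (`PadicAlgCl.norm_extends`,
`Padic.eq_padicNorm`).

NOT here: Ridout's theorem itself (the hypothesis `hRat`, proved by the neighbouring stubs), and
its consequences for abc triples.
-/

open scoped Polynomial

-- the `Summit.ABC.ABC` namespace is mandated for Summit-side theorem files
set_option linter.dupNamespace false

namespace Summit.ABC.ABC.Theorems.DeepRegimeABC

/-- The norm of `\overline{ℚ_p} = PadicAlgCl p` restricted to `ℚ` is the `p`-adic norm:
`‖(q : PadicAlgCl p)‖ = |q|_p`. [folklore] -/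
theorem norm_ratCast_padicAlgCl (p : ℕ) [Fact p.Prime] (q : ℚ) :
    ‖(q : PadicAlgCl p)‖ = ((padicNorm p q : ℚ) : ℝ) := by
  have h1 : (q : PadicAlgCl p) = algebraMap ℚ_[p] (PadicAlgCl p) (q : ℚ_[p]) :=
    (map_ratCast _ q).symm
  rw [h1, PadicAlgCl.norm_extends, Padic.eq_padicNorm]

/-- For `ρ ∈ ℚ` and `m ∈ ℤ`, `‖ρ − m‖` in `\overline{ℚ_p}` is `|ρ − m|_p`. [folklore] -/
theorem norm_ratCast_sub_intCast_padicAlgCl (p : ℕ) [Fact p.Prime] (ρ : ℚ) (m : ℤ) :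
    ‖(ρ : PadicAlgCl p) - (m : PadicAlgCl p)‖ = ((padicNorm p (ρ - m) : ℚ) : ℝ) := by
  rw [← norm_ratCast_padicAlgCl, Rat.cast_sub, Rat.cast_intCast]

/-- Reindexing a product over a finite set of primes `S ⊆ ℕ` along the corresponding finite set
`S'` of `Nat.Primes` (`p ∈ S' ↔ ↑p ∈ S`). [folklore] -/
theorem prod_primes_eq_prod {M : Type*} [CommMonoid M] {S : Finset ℕ}
    (hS : ∀ p ∈ S, p.Prime) {S' : Finset Nat.Primes} (hS' : ∀ p : Nat.Primes, p ∈ S' ↔ (p : ℕ) ∈ S)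
    (g : ℕ → M) :
    ∏ p ∈ S', g p = ∏ p ∈ S, g p := by
  refine Finset.prod_nbij (fun p : Nat.Primes => (p : ℕ)) (fun p hp => (hS' p).1 hp)
    (Nat.Primes.coe_nat_injective.injOn) (fun p hp => ?_) (fun _ _ => rfl)
  exact ⟨⟨p, hS p hp⟩, (hS' _).2 hp, rfl⟩

/-- The finite set of `Nat.Primes` underlying a finite set of natural numbers. [folklore] -/
theorem exists_finset_primes (S : Finset ℕ) :
    ∃ S' : Finset Nat.Primes, ∀ p : Nat.Primes, p ∈ S' ↔ (p : ℕ) ∈ S := by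
  classical
  exact ⟨S.subtype Nat.Prime, fun p => Finset.mem_subtype⟩

/-- **Ridout's theorem over `ℚ`, integer `p`-adic targets, `padicNorm` form.** Assume Ridout's
theorem over `ℚ` in the `PadicAlgCl` vocabulary (`hRat`: for a finite set `S` of primes, roots
`θ_p ∈ \overline{ℚ_p}` of monic `Q_p ∈ ℤ[X]` of degree `≥ 1` and `κ > 2`, only finitely many
rationals `ρ` with `|ρ| ≤ 1` satisfy `|ρ| · ∏_{p∈S} min(1, ‖ρ − θ_p‖) ≤ den(ρ)^{−κ}`). Then for a
finite set `S ⊆ ℕ` of primes, integers `k_p` and `κ > 2`, only finitely many rationals `ρ` with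
`|ρ| ≤ 1` satisfy `|ρ| · ∏_{p∈S} min(1, |ρ − k_p|_p) ≤ den(ρ)^{−κ}`: apply `hRat` to
`S.subtype Nat.Prime`, `Q_p = X − k_p`, `θ_p = k_p`; the two products agree termwise since the
norm of `\overline{ℚ_p}` extends `|·|_p`.
[cite: BombieriGubler2006, Thm. 6.2.3 with 6.2.5–6.2.6 (K = ℚ, β ∈ ℤ)] -/
theorem stub_zeroInt_of_rat
    (hRat : ∀ (S : Finset Nat.Primes) (Q : Nat.Primes → ℤ[X]),
      (∀ p ∈ S, (Q p).Monic) → (∀ p ∈ S, 1 ≤ (Q p).natDegree) →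
      ∀ (θ : ∀ p : Nat.Primes, @PadicAlgCl (p : ℕ) ⟨p.2⟩),
      (∀ p ∈ S, Polynomial.aeval (θ p) (Q p) = 0) → ∀ (κ : ℝ), 2 < κ →
      {ρ : ℚ | |(ρ : ℝ)| ≤ 1 ∧
        |(ρ : ℝ)| * (∏ p ∈ S, min (1 : ℝ) ‖(ρ : @PadicAlgCl (p : ℕ) ⟨p.2⟩) - θ p‖) ≤
          (ρ.den : ℝ) ^ (-κ)}.Finite) :
    ∀ (S : Finset ℕ), (∀ p ∈ S, p.Prime) → ∀ (k : ℕ → ℤ) (κ : ℝ), 2 < κ →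
      {ρ : ℚ | |(ρ : ℝ)| ≤ 1 ∧
        |(ρ : ℝ)| * (∏ p ∈ S, min (1 : ℝ) ((padicNorm p (ρ - k p) : ℚ) : ℝ)) ≤
          (ρ.den : ℝ) ^ (-κ)}.Finite := by
  intro S hS k κ hκ
  have _inst (p : Nat.Primes) : Fact (p : ℕ).Prime := ⟨p.2⟩
  -- the places as a finite set of `Nat.Primes`
  obtain ⟨S', hS'⟩ := exists_finset_primes S
  -- Ridout's theorem for the places `S'`, targets `θ_p = k_p`, polynomials `Q_p = X - k_p`
  have hfin := hRat S' (fun p => Polynomial.X - Polynomial.C (k p))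
    (fun p _ => Polynomial.monic_X_sub_C _)
    (fun p _ => by rw [Polynomial.natDegree_X_sub_C])
    (fun p => ((k p : ℤ) : PadicAlgCl (p : ℕ)))
    (fun p _ => by simp) κ hκ
  -- the two products agree
  have hprod : ∀ ρ : ℚ,
      (∏ p ∈ S', min (1 : ℝ) ‖(ρ : PadicAlgCl (p : ℕ)) - ((k p : ℤ) : PadicAlgCl (p : ℕ))‖) =
      ∏ p ∈ S, min (1 : ℝ) ((padicNorm p (ρ - k p) : ℚ) : ℝ) := by
    intro ρ
    rw [← prod_primes_eq_prod hS hS']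
    refine Finset.prod_congr rfl fun p _ => ?_
    rw [norm_ratCast_sub_intCast_padicAlgCl]
  refine hfin.subset ?_
  rintro ρ ⟨h1, h2⟩
  refine ⟨h1, ?_⟩
  rw [hprod ρ]
  exact h2

end Summit.ABC.ABC.Theorems.DeepRegimeABC
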